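import Literature.Topology.FourManifolds.GaussDiagrams
import Literature.Topology.FourManifolds.GaussDiagramsRMoves
import HarnessLib

/-!
# Gauss diagrams of oriented links (first file of the link tower)

The knot tower of this library (`GaussDiagrams` → `KhResolutions` → `KhComplex` → `LeeRasmussen`, with
the Reidemeister programme `KhCurl*`, `KhBigon*`, `KhAntiBigon*`, `KhTriangle*`) is built on
`GaussDiagram`: `n` chords on ONE based circle with `2n` marked points. Rasmussen's slice-genus
arguments (Rasmussen (2010), §4: the maps induced on Lee's complex by the elementary cobordisms of a
movie — Reidemeister moves, births, deaths, saddles) leave the class of knot diagrams at the first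
saddle, so the named facts `eq_zero_of_isSmoothlySlice`, `abs_le_two_mul_sliceGenus`,
`HasRasmussenInvariant.eq_of_isConcordant` (`Rasmussen.lean`) need Gauss diagrams of LINKS and their
cube (consuming interfaces already in the tree: `eq_zero_of_isSmoothlySlice_of_filtered`,
`RasmussenSliceProofs.lean`; `eq_zero_of_isSmoothlySlice_of_canonical`, `RasmussenSliceCanonicalProofs.lean`).
This file is the first, purely combinatorial, layer (D1 in the census of crux `ZseThesis`,
stmt-SmoothPoincare4-0364): the data type and the elementary Morse moves.

A **link Gauss diagram** (`LinkGaussDiagram`) is knot-style Gauss data — `n` chords, `overPos`,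
`underPos : Fin n → Fin (2n)`, `sign`, `bijective`, verbatim as in `GaussDiagram` — together with

* a TRAVERSAL SUCCESSOR `next : Equiv.Perm (Fin (2 * n))` whose cycles are the components met by
  chords (GPV (2000), §1: a Gauss diagram of an `m`-component link is drawn on `m` circles; here the
  circles are the cycles of `next`, and a knot diagram has `next = finRotate (2 * n)`, `p ↦ p + 1`);
* a number `free : ℕ` of chord-free round components (the unknot at the end of a movie of a slice
  disc is `n = 0, free = 1`; Khovanov's complex sees a crossingless circle as a factor `V`
  wherever it sits in the plane, Khovanov (2000), §4.2, Bar-Natan (2002), §3.1).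

Provided here: the embedding `ofGaussDiagram` of the knot tower (injective) and its value on
`GaussDiagram.empty`; arcs `Arc = Fin (2n) ⊕ Fin free` with `arcOut p`, `arcIn p = arcOut (next⁻¹ p)`
(on a knot diagram this is `GaussDiagram.arcIn`, the arc leaving `p - 1`); the crossingless diagrams
`unknots k`; and the combinatorial Morse moves — `birth`, `death` (one free circle more / less) and
the oriented `saddle p q` along the arcs leaving two marked points, which is **`next ↦ next * swap p q`**
(it reconnects `p → next q` and `q → next p`, merging the components of `p` and `q` when they differ
and splitting their common component otherwise; Rasmussen (2010), §4.1, Fig. 6), with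
`saddle_next_left/right/of_ne` and the involutivity `saddle_saddle`.

Not in this file (next layers): the cube of resolutions and the Khovanov / Frobenius / Lee complexes
of a link diagram (same formulas as the knot tower with `p + 1` replaced by `next p`, to agree
definitionally with it on `ofGaussDiagram`), realisability through a regular projection of a
`Link ι`, Gauss's parity / merge-or-split for realisable link diagrams, Reidemeister moves (chord
insertions updating `next`), and the chain maps of the Morse moves with Rasmussen's Prop. 4.1.

## References

* M. Goussarov, M. Polyak, O. Viro, *Finite-type invariants of classical and virtual knots*,
  Topology 39 (2000) 1045–1068, §1 (Gauss diagrams of knots and links). [cite: GPV2000, §1]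
* J. Rasmussen, *Khovanov homology and the slice genus*, Invent. Math. 182 (2010), §4.1
  (elementary cobordisms: Reidemeister moves and Morse moves). [cite: Rasmussen2010, §4.1]
* M. Khovanov, *A categorification of the Jones polynomial*, Duke Math. J. 101 (2000), §4.2,
  §6 (link diagrams, cobordisms). [cite: Khovanov2000, §4.2]
* D. Bar-Natan, *Khovanov's homology for tangles and cobordisms*, Geom. Topol. 9 (2005), §8
  (movies). [cite: BarNatan2005, §8]
-/

noncomputable section

open Function

namespace Literature.Topology.FourManifolds

/-- **A Gauss diagram of an oriented link**: `n` chords on `2n` marked points (`overPos`, `underPos`,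
`sign`, `bijective` exactly as in `GaussDiagram`), a traversal successor `next` (one cycle per component
met by chords) and a number `free` of chord-free components. GPV (2000), §1; Khovanov (2000), §4.2.
[cite: GPV2000, §1] -/
structure LinkGaussDiagram where
  /-- The number of chords (crossings). -/
  n : ℕ
  /-- The number of chord-free (round) components. -/
  free : ℕ
  /-- The position of the over-passage of crossing `i`. -/
  overPos : Fin n → Fin (2 * n)
  /-- The position of the under-passage of crossing `i`. -/
  underPos : Fin n → Fin (2 * n)
  /-- The sign of crossing `i`. -/
  sign : Fin n → ℤˣ
  /-- Every marked point is an endpoint of exactly one chord. -/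
  bijective : Bijective (Sum.elim overPos underPos)
  /-- The traversal successor of a marked point along the orientation of its component. -/
  next : Equiv.Perm (Fin (2 * n))

namespace LinkGaussDiagram

variable (L : LinkGaussDiagram)

/-- **The knot tower embeds**: a knot Gauss diagram is a link Gauss diagram with successor `p ↦ p + 1`
(`finRotate`) and no free component. GPV (2000), §1. [cite: GPV2000, §1] -/
def ofGaussDiagram (G : GaussDiagram) : LinkGaussDiagram where
  n := G.n
  free := 0
  overPos := G.overPos
  underPos := G.underPos
  sign := G.sign
  bijective := G.bijective
  next := finRotate (2 * G.n)

/-- The embedding preserves the number of chords. [folklore] -/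
@[simp] theorem ofGaussDiagram_n (G : GaussDiagram) : (ofGaussDiagram G).n = G.n := rfl

/-- The embedding is injective (a knot diagram is recovered from its image). [folklore] -/
theorem ofGaussDiagram_injective : Injective ofGaussDiagram := by
  intro G G' h
  have hn : G.n = G'.n := congrArg LinkGaussDiagram.n h
  obtain ⟨n, o, u, s, b⟩ := G
  obtain ⟨n', o', u', s', b'⟩ := G'
  cases hn
  simp only [ofGaussDiagram, LinkGaussDiagram.mk.injEq, heq_eq_eq, true_and, and_true] at h
  obtain ⟨rfl, rfl, rfl⟩ := h
  rfl

/-- The crossingless diagrams: no chord, `k` free circles (`k = 1` is the crossingless unknot diagram at the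
end of a movie of a slice disc; `k` circles = the `k`-component unlink). Khovanov (2000), §4.2.
[cite: Khovanov2000, §4.2] -/
def unknots (k : ℕ) : LinkGaussDiagram where
  n := 0
  free := k
  overPos := Fin.elim0
  underPos := Fin.elim0
  sign := Fin.elim0
  bijective := ⟨fun a ↦ by rcases a with a | a <;> exact a.elim0, fun b ↦ b.elim0⟩
  next := 1

/-- The image of the empty knot diagram is `unknots 0` — NOT `unknots 1`: the knot tower's
`GaussDiagram.empty` is a crossingless circle encoded by `n = 0` with ONE arc by the convention
`arcCount = max (2n) 1` (`KhResolutions`), which the cube of the link tower has to reproduce on the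
image of `ofGaussDiagram` (flagged for the next layer). [folklore] -/
theorem ofGaussDiagram_empty : ofGaussDiagram GaussDiagram.empty = unknots 0 := by
  simp only [ofGaussDiagram, unknots, LinkGaussDiagram.mk.injEq, GaussDiagram.empty, heq_eq_eq, true_and]
  exact Equiv.ext fun a ↦ a.elim0

/-- The arcs of a link diagram: the arc leaving each marked point, and the free circles (for `n = 0`,
`free = 0` there is no arc, unlike `GaussDiagram.Arc`, see `ofGaussDiagram_empty`). Viro (2004), §2.
[cite: Viro2004, §2] -/
abbrev Arc : Type := Fin (2 * L.n) ⊕ Fin L.free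

/-- The arc leaving the marked point `p`. [folklore] -/
def arcOut (p : Fin (2 * L.n)) : L.Arc := .inl p

/-- The arc entering the marked point `p`: the arc leaving its traversal predecessor. [folklore] -/
def arcIn (p : Fin (2 * L.n)) : L.Arc := .inl (L.next.symm p)

/-- On a knot diagram the arc entering `p` leaves `p - 1 (mod 2n)`, as in `GaussDiagram.arcIn`. [folklore] -/
theorem arcIn_ofGaussDiagram (G : GaussDiagram) (p : Fin (2 * G.n)) :
    (ofGaussDiagram G).arcIn p = .inl ((finRotate (2 * G.n)).symm p) := rfl

-- Two marked points lie on the same component iff `L.next.SameCycle p q` (Mathlib's `Equiv.Perm.SameCycle`).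

/-- **Birth** of a chord-free circle (elementary cobordism of index `0`). Rasmussen (2010), §4.1.
[cite: Rasmussen2010, §4.1] -/
def birth : LinkGaussDiagram := { L with free := L.free + 1 }

/-- **Death** of a chord-free circle (elementary cobordism of index `2`; meaningful when `0 < free`).
Rasmussen (2010), §4.1. [cite: Rasmussen2010, §4.1] -/
def death : LinkGaussDiagram := { L with free := L.free - 1 }

/-- **Saddle** (oriented band) between the arcs leaving two marked points `p ≠ q`: the successor becomes
`next * swap p q`, i.e. `p ↦ next q`, `q ↦ next p`, all other successors unchanged; it merges the components
of `p` and `q` if they differ and splits their common component otherwise. (Saddles involving a free circle: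
merging a free circle into an arc is `death`-shaped on `free` with `next` unchanged; splitting a chord-free
circle off one arc is `birth`-shaped.) Rasmussen (2010), §4.1. [cite: Rasmussen2010, §4.1] -/
def saddle (p q : Fin (2 * L.n)) : LinkGaussDiagram := { L with next := L.next * Equiv.swap p q }

/-- The saddle reconnects `p` to the old successor of `q`. [folklore] -/
theorem saddle_next_left (p q : Fin (2 * L.n)) : (L.saddle p q).next p = L.next q := by
  show (L.next * Equiv.swap p q) p = L.next q
  rw [Equiv.Perm.mul_apply, Equiv.swap_apply_left]

/-- The saddle reconnects `q` to the old successor of `p`. [folklore] -/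
theorem saddle_next_right (p q : Fin (2 * L.n)) : (L.saddle p q).next q = L.next p := by
  show (L.next * Equiv.swap p q) q = L.next p
  rw [Equiv.Perm.mul_apply, Equiv.swap_apply_right]

/-- The saddle changes no other successor. [folklore] -/
theorem saddle_next_of_ne {p q r : Fin (2 * L.n)} (hp : r ≠ p) (hq : r ≠ q) :
    (L.saddle p q).next r = L.next r := by
  show (L.next * Equiv.swap p q) r = L.next r
  rw [Equiv.Perm.mul_apply, Equiv.swap_apply_of_ne_of_ne hp hq]

/-- A saddle is an involution on the successor data (the same band read backwards). [folklore] -/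
theorem saddle_saddle (p q : Fin (2 * L.n)) : (L.saddle p q).saddle p q = L := by
  obtain ⟨n, f, o, u, s, b, nx⟩ := L
  show (⟨n, f, o, u, s, b, nx * Equiv.swap p q * Equiv.swap p q⟩ : LinkGaussDiagram) = ⟨n, f, o, u, s, b, nx⟩
  rw [mul_assoc, Equiv.swap_mul_self, mul_one]

end LinkGaussDiagram

end Literature.Topology.FourManifolds

end
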